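import Mathlib.RepresentationTheory.Irreducible
import Mathlib.LinearAlgebra.Determinant
import Mathlib.Analysis.Complex.Polynomial.Basic
import Summits.Langlands.Langlands.Theorems.IrreducibilityBySelfDualityReciprocityUpToIrreducibilityRStringDefs
import HarnessLib

/-!
# Unramified twists and Schur's lemma for heads of strings (toward stub S-17a-B of line `Sketch`,
# crux stmt-Langlands-17925 `IrreducibilityBySelfDuality.ReciprocityUpToIrreducibilityR`)

Henniart's reconstruction (Bull. SMF 130 (2002), Thm 1.7 (a), §4) reads the multiset of strings
`ρ_i ⊗ Sp(d_i)` of a Frobenius-semisimple Weil–Deligne representation off `Hom`-dimensions against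
strings; the elementary inputs proved here (vocabulary `twistRep`, `IsoTw`, `IsWIrreducible` in
`…RStringDefs`):

* bookkeeping of unramified twists `ρ ⊗ ‖·‖^b` (`twistRep_zero`, `twistRep_twistRep`, `IsoTw.trans`, …);
* **uniqueness of the twist** (registered sub-goal `stub_isoTw_unique`): `ρ_A ⊗ ‖·‖^i ≅ ρ ≅ ρ_A ⊗ ‖·‖^{i'}`
  with `A ≠ 0` forces `i = i'` (determinants: `q^{i·dim A} = q^{i'·dim A}` at an element of degree `1`);
* `W_F`-irreducible subspaces give irreducible subrepresentations (Mathlib `Representation.IsIrreducible`),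
  twists of irreducibles are irreducible, and **Schur**: two `W_F`-maps from an irreducible `ρ` into an
  irreducible `W_F`-stable subspace are proportional (Mathlib `algebraMap_intertwiningMap_bijective_of_isAlgClosed`).

Pure representation theory over `ℂ`; no definitions; standard axioms only.
-/

noncomputable section

set_option linter.dupNamespace false

open Module
open Literature.NumberTheory.Automorphic Literature.NumberTheory.GaloisRepresentations
open Literature.NumberTheory.GaloisRepresentations.WeilGroup
open Literature.NumberTheory.GaloisRepresentations.IsNonarchimedeanLocalField

namespace Summit.Langlands.Langlands.Theorems.ReciprocityUpToIrreducibilityR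

variable {F : Type} [Field F] [ValuativeRel F] [TopologicalSpace F] [IsNonarchimedeanLocalField F]

/-! ## Bookkeeping of unramified twists -/

section Twist

variable {H : Type*} [AddCommGroup H] [Module ℂ H] {H' : Type*} [AddCommGroup H'] [Module ℂ H']
  {H'' : Type*} [AddCommGroup H''] [Module ℂ H'']

/-- The residue cardinality is non-zero in `ℂ`. [folklore] -/
theorem qC_ne_zero : (residueFieldCard F : ℂ) ≠ 0 := by exact_mod_cast residueFieldCard_ne_zero F

/-- `ρ ⊗ ‖·‖^0 = ρ`. [cite: TateCorvallis1979, (4.1.4)] -/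
theorem twistRep_zero (ρ : Representation ℂ (WeilGroup F) H) : twistRep ρ 0 = ρ := by
  refine MonoidHom.ext fun w => ?_
  rw [show twistRep ρ 0 w = (((residueFieldCard F : ℂ) ^ (deg w)) ^ (0 : ℤ)) • ρ w from rfl,
    zpow_zero, one_smul]

/-- `(ρ ⊗ ‖·‖^a) ⊗ ‖·‖^b = ρ ⊗ ‖·‖^{a+b}`. [cite: TateCorvallis1979, (4.1.4)] -/
theorem twistRep_twistRep (ρ : Representation ℂ (WeilGroup F) H) (a b : ℤ) :
    twistRep (twistRep ρ a) b = twistRep ρ (a + b) := by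
  refine MonoidHom.ext fun w => LinearMap.ext fun x => ?_
  simp only [twistRep_apply, smul_smul]
  rw [zpow_add₀ (zpow_ne_zero _ qC_ne_zero), mul_comm]

/-- An isomorphism `ρ₁ ≅ ρ₂` twists to `ρ₁ ⊗ ‖·‖^b ≅ ρ₂ ⊗ ‖·‖^b`. [cite: TateCorvallis1979, (4.1.4)] -/
def equivTwist {ρ₁ : Representation ℂ (WeilGroup F) H} {ρ₂ : Representation ℂ (WeilGroup F) H'}
    (e : ρ₁.Equiv ρ₂) (b : ℤ) : (twistRep ρ₁ b).Equiv (twistRep ρ₂ b) :=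
  Representation.Equiv.mk e.toLinearEquiv fun w => by
    refine LinearMap.ext fun x => ?_
    simp only [LinearMap.coe_comp, Function.comp_apply, twistRep_apply, map_smul]
    congr 1
    exact e.toIntertwiningMap.isIntertwining ρ₁ ρ₂ w x

/-- `IsoTw ρ 0 ρ` (reflexivity). [folklore] -/
theorem isoTw_zero_refl (ρ : Representation ℂ (WeilGroup F) H) : IsoTw ρ 0 ρ := by
  rw [IsoTw, twistRep_zero]; exact ⟨Representation.Equiv.refl ρ⟩

/-- Transitivity with additive twists: `ρ₁ ⊗ ‖·‖^a ≅ ρ₂` and `ρ₂ ⊗ ‖·‖^b ≅ ρ₃` give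
`ρ₁ ⊗ ‖·‖^{a+b} ≅ ρ₃`. [folklore] -/
theorem IsoTw.trans {ρ₁ : Representation ℂ (WeilGroup F) H} {ρ₂ : Representation ℂ (WeilGroup F) H'}
    {ρ₃ : Representation ℂ (WeilGroup F) H''} {a b : ℤ} (h₁ : IsoTw ρ₁ a ρ₂) (h₂ : IsoTw ρ₂ b ρ₃) :
    IsoTw ρ₁ (a + b) ρ₃ := by
  obtain ⟨e₁⟩ := h₁
  obtain ⟨e₂⟩ := h₂
  rw [IsoTw, ← twistRep_twistRep]
  exact ⟨(equivTwist e₁ b).trans e₂⟩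

/-- Symmetry: `ρ₁ ⊗ ‖·‖^a ≅ ρ₂` gives `ρ₂ ⊗ ‖·‖^{-a} ≅ ρ₁`. [folklore] -/
theorem IsoTw.symm {ρ₁ : Representation ℂ (WeilGroup F) H} {ρ₂ : Representation ℂ (WeilGroup F) H'}
    {a : ℤ} (h : IsoTw ρ₁ a ρ₂) : IsoTw ρ₂ (-a) ρ₁ := by
  obtain ⟨e⟩ := h
  have e' : (twistRep ρ₂ (-a)).Equiv (twistRep (twistRep ρ₁ a) (-a)) := (equivTwist e (-a)).symm
  rw [twistRep_twistRep, add_neg_cancel, twistRep_zero] at e'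
  exact ⟨e'⟩

/-- Two representations twisting to the same one differ by the difference of the twists:
`ρ₁ ⊗ ‖·‖^a ≅ L` and `ρ₂ ⊗ ‖·‖^b ≅ L` give `ρ₁ ⊗ ‖·‖^{a-b} ≅ ρ₂`. [folklore] -/
theorem IsoTw.of_common {ρ₁ : Representation ℂ (WeilGroup F) H} {ρ₂ : Representation ℂ (WeilGroup F) H'}
    {L : Representation ℂ (WeilGroup F) H''} {a b : ℤ} (h₁ : IsoTw ρ₁ a L) (h₂ : IsoTw ρ₂ b L) :
    IsoTw ρ₁ (a - b) ρ₂ := by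
  rw [sub_eq_add_neg]; exact h₁.trans h₂.symm

/-- **Uniqueness of the twist.**  If `ρ_A ⊗ ‖·‖^i ≅ ρ` and `ρ_A ⊗ ‖·‖^{i'} ≅ ρ` with `A ≠ 0`
finite-dimensional, then `i = i'`: comparing determinants at `w` of degree `1`,
`q^{i·dim A} det ρ_A(w) = q^{i'·dim A} det ρ_A(w)` with `det ρ_A(w) ≠ 0` and `q ≥ 2`.
[cite: TateCorvallis1979, (4.1.4)] -/
theorem isoTw_unique {A : Type*} [AddCommGroup A] [Module ℂ A] [FiniteDimensional ℂ A] [Nontrivial A]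
    {ρA : Representation ℂ (WeilGroup F) A} {ρ : Representation ℂ (WeilGroup F) H} {i i' : ℤ}
    (h : IsoTw ρA i ρ) (h' : IsoTw ρA i' ρ) : i = i' := by
  -- `ρA ⊗ ‖·‖^{i - i'} ≅ ρA`
  obtain ⟨e⟩ := h.of_common h'
  obtain ⟨w, hw⟩ := WeilDeligneRep.exists_deg_eq_one (F := F)
  set q : ℂ := (residueFieldCard F : ℂ) with hq
  have hconj : ρA w = (e.toLinearEquiv : A →ₗ[ℂ] A) ∘ₗ (twistRep ρA (i - i') w) ∘ₗ
      (e.toLinearEquiv.symm : A →ₗ[ℂ] A) := by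
    have h1 : (e.toLinearEquiv : A →ₗ[ℂ] A) ∘ₗ twistRep ρA (i - i') w = ρA w ∘ₗ (e.toLinearEquiv : A →ₗ[ℂ] A) :=
      e.toIntertwiningMap.isIntertwining' w
    rw [← LinearMap.comp_assoc, h1, LinearMap.comp_assoc, ← LinearEquiv.coe_trans,
      LinearEquiv.symm_trans_self, LinearEquiv.refl_toLinearMap, LinearMap.comp_id]
  have hdet : LinearMap.det (ρA w) =
      ((q ^ (deg w)) ^ (i - i')) ^ finrank ℂ A * LinearMap.det (ρA w) := by
    conv_lhs => rw [hconj, LinearMap.det_conj (twistRep ρA (i - i') w) e.toLinearEquiv]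
    rw [show twistRep ρA (i - i') w = ((q ^ (deg w)) ^ (i - i')) • ρA w from rfl, LinearMap.det_smul]
  have hdet0 : LinearMap.det (ρA w) ≠ 0 := by
    have h1 : LinearMap.det (ρA w) * LinearMap.det (ρA w⁻¹) = 1 := by
      rw [← map_mul, ← map_mul, mul_inv_cancel, map_one, map_one]
    exact left_ne_zero_of_mul_eq_one h1
  have hone : ((q ^ (deg w)) ^ (i - i')) ^ finrank ℂ A = 1 := by
    have := hdet
    rw [eq_comm, mul_eq_right₀ hdet0] at this
    exact this
  rw [hw, zpow_one, ← zpow_natCast, ← zpow_mul] at hone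
  -- `q ^ ((i - i') * dim A) = 1` with `q ≥ 2` real
  have hnorm : (residueFieldCard F : ℝ) ^ ((i - i') * (finrank ℂ A : ℤ)) = 1 := by
    have := congrArg (fun z : ℂ => ‖z‖) hone
    simpa [hq] using this
  have hq1 : (1 : ℝ) < (residueFieldCard F : ℝ) := by exact_mod_cast one_lt_residueFieldCard F
  have hexp : (i - i') * (finrank ℂ A : ℤ) = 0 := by
    have hinj := zpow_right_injective₀ (zero_lt_one.trans hq1) hq1.ne'
    exact hinj (by simp only [hnorm, zpow_zero])
  have hn : (finrank ℂ A : ℤ) ≠ 0 := by exact_mod_cast (finrank_pos (R := ℂ) (M := A)).ne'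
  have := (mul_eq_zero.mp hexp).resolve_right hn
  omega

end Twist

/-! ## Irreducibility transfers and Schur's lemma -/

section Schur

variable {V : Type*} [AddCommGroup V] [Module ℂ V] {H : Type*} [AddCommGroup H] [Module ℂ H]

/-- A `W_F`-irreducible subspace carries an irreducible subrepresentation (Mathlib
`Representation.IsIrreducible` = the lattice of subrepresentations is simple). [folklore] -/
theorem IsWIrreducible.isIrreducible_subrepresentation {r : WeilDeligneRep F ℂ V} {L : Submodule ℂ V}
    (h : IsWIrreducible r L) : (r.ρ.subrepresentation L h.2.1).IsIrreducible := by
  set ρL := r.ρ.subrepresentation L h.2.1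
  have hinj : Function.Injective (Submodule.map L.subtype : Submodule ℂ L → Submodule ℂ V) :=
    Submodule.map_injective_of_injective L.injective_subtype
  -- a subrepresentation of `ρL` pushes forward to a `W_F`-stable subspace of `L`
  have key : ∀ S : Subrepresentation ρL, S = ⊥ ∨ S = ⊤ := by
    intro S
    have hst : IsWStable r (S.toSubmodule.map L.subtype) := by
      intro w
      rintro _ ⟨x, hx, rfl⟩
      exact ⟨ρL w x, S.apply_mem_toSubmodule w hx, rfl⟩
    rcases h.2.2 _ (Submodule.map_subtype_le L S.toSubmodule) hst with h0 | h1
    · left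
      apply Subrepresentation.toSubmodule_injective
      exact hinj (by rw [h0]; exact (Submodule.map_bot _).symm)
    · right
      apply Subrepresentation.toSubmodule_injective
      exact hinj (by rw [h1]; exact (Submodule.map_subtype_top L).symm)
  have hne : (⊥ : Subrepresentation ρL) ≠ ⊤ := by
    intro hbt
    have h1 : (⊥ : Submodule ℂ L) = ⊤ := congrArg Subrepresentation.toSubmodule hbt
    have h2 : (⊥ : Submodule ℂ L).map L.subtype = (⊤ : Submodule ℂ L).map L.subtype := by rw [h1]
    rw [Submodule.map_bot, Submodule.map_subtype_top] at h2
    exact h.1 h2.symm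
  haveI : Nontrivial (Subrepresentation ρL) := ⟨⟨⊥, ⊤, hne⟩⟩
  exact ⟨key⟩

/-- The subrepresentations of `ρ ⊗ ‖·‖^b` are those of `ρ` (the twist is by non-zero scalars).
[folklore] -/
def subrepresentationTwistEquiv (ρ : Representation ℂ (WeilGroup F) H) (b : ℤ) :
    Subrepresentation (twistRep ρ b) ≃o Subrepresentation ρ where
  toFun S := ⟨S.toSubmodule, fun w x hx => by
    have h := S.apply_mem_toSubmodule w hx
    rw [twistRep_apply] at h
    have h' := S.toSubmodule.smul_mem ((((residueFieldCard F : ℂ) ^ (deg w)) ^ b)⁻¹) h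
    rwa [smul_smul, inv_mul_cancel₀ (zpow_ne_zero _ (zpow_ne_zero _ qC_ne_zero)), one_smul] at h'⟩
  invFun S := ⟨S.toSubmodule, fun w x hx => by
    rw [twistRep_apply]
    exact S.toSubmodule.smul_mem _ (S.apply_mem_toSubmodule w hx)⟩
  left_inv S := by apply Subrepresentation.toSubmodule_injective; rfl
  right_inv S := by apply Subrepresentation.toSubmodule_injective; rfl
  map_rel_iff' := Iff.rfl

/-- Twists of irreducible representations are irreducible. [folklore] -/
theorem isIrreducible_twistRep {ρ : Representation ℂ (WeilGroup F) H} (h : ρ.IsIrreducible) (b : ℤ) :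
    (twistRep ρ b).IsIrreducible :=
  (subrepresentationTwistEquiv ρ b).isSimpleOrder_iff.mpr h

/-- **Schur's lemma, proportionality form.**  Let `ρ` be an irreducible representation of `W_F` on a
finite-dimensional `H`, and `L ≤ V` a `W_F`-irreducible subspace of `σ`.  Two `W_F`-equivariant maps
`f₀, f : H → V` with values in `L`, `f₀ ≠ 0`, are proportional: `f = c • f₀` (restrict to `L`, invert
the bijective `f₀`, and use that `End_W(ρ) = ℂ`, Mathlib
`algebraMap_intertwiningMap_bijective_of_isAlgClosed`). [folklore] -/
theorem exists_smul_eq_of_intertwining [FiniteDimensional ℂ H] {ρ : Representation ℂ (WeilGroup F) H}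
    (hρ : ρ.IsIrreducible) {σ : WeilDeligneRep F ℂ V} {L : Submodule ℂ V} (hL : IsWIrreducible σ L)
    {f₀ f : H →ₗ[ℂ] V} (hf₀ : ∀ w, f₀ ∘ₗ ρ w = σ.ρ w ∘ₗ f₀) (hf₀L : ∀ x, f₀ x ∈ L)
    (hf : ∀ w, f ∘ₗ ρ w = σ.ρ w ∘ₗ f) (hfL : ∀ x, f x ∈ L) (h0 : f₀ ≠ 0) :
    ∃ c : ℂ, f = c • f₀ := by
  haveI := hρ
  haveI := hL.isIrreducible_subrepresentation
  set ρL := σ.ρ.subrepresentation L hL.2.1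
  -- restrict the codomains to `L`
  let g₀ : ρ.IntertwiningMap ρL :=
    (LinearMap.codRestrict L f₀ hf₀L).intertwiningMap_of_isIntertwiningMap ρ ρL fun w x =>
      Subtype.ext (congr($(hf₀ w) x))
  let g : ρ.IntertwiningMap ρL :=
    (LinearMap.codRestrict L f hfL).intertwiningMap_of_isIntertwiningMap ρ ρL fun w x =>
      Subtype.ext (congr($(hf w) x))
  have hg₀ : ∀ x, (g₀ x : V) = f₀ x := fun x => rfl
  have hg : ∀ x, (g x : V) = f x := fun x => rfl
  have hg₀0 : g₀ ≠ 0 := by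
    intro h
    apply h0
    ext x
    have := congrArg (fun φ : ρ.IntertwiningMap ρL => ((φ x : L) : V)) h
    simpa [hg₀] using this
  have hbij : Function.Bijective g₀ :=
    (Representation.IsIrreducible.bijective_or_eq_zero g₀).resolve_right hg₀0
  set e₀ := g₀.ofBijective hbij
  -- `e₀⁻¹ ∘ g ∈ End_W(ρ) = ℂ`
  obtain ⟨c, hc⟩ :=
    (Representation.IsIrreducible.algebraMap_intertwiningMap_bijective_of_isAlgClosed (ρ := ρ)).2
      (e₀.symm.toIntertwiningMap.comp g)
  refine ⟨c, LinearMap.ext fun x => ?_⟩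
  have h1 : (e₀.symm.toIntertwiningMap.comp g) x = c • x := by
    rw [← hc]; rfl
  have h2 : g x = e₀ (c • x) := by
    rw [← h1]
    exact (e₀.apply_symm_apply (g x)).symm
  have h3 : (g x : V) = c • (g₀ x : V) := by
    rw [h2, map_smul]
    rfl
  rw [← hg, h3, hg₀, LinearMap.smul_apply]

end Schur

/-- **Registered sub-goal `stub_isoTw_unique`** (uniqueness of the unramified twist relating two
representations, the source being non-zero finite-dimensional). [cite: TateCorvallis1979, (4.1.4)] -/
theorem stub_isoTw_unique : ∀ (F : Type) [Field F] [ValuativeRel F] [TopologicalSpace F] [IsNonarchimedeanLocalField F] (A : Type) [AddCommGroup A] [Module ℂ A] [FiniteDimensional ℂ A] [Nontrivial A] (H : Type) [AddCommGroup H] [Module ℂ H] (ρA : Representation ℂ (WeilGroup F) A) (ρ : Representation ℂ (WeilGroup F) H) (i i' : ℤ), IsoTw ρA i ρ → IsoTw ρA i' ρ → i = i' :=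
  fun _ _ _ _ _ _ _ _ _ _ _ _ _ _ _ _ _ h h' => isoTw_unique h h'

end Summit.Langlands.Langlands.Theorems.ReciprocityUpToIrreducibilityR

end
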